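/-
Copyright (c) 2026. All rights reserved.
Released under Apache 2.0 license as described in the file LICENSE.
-/
import Literature.AlgebraicGeometry.Pohlmann1968.MultiquadraticCMFieldWalshValuesQuadraticSubfields
import Literature.AlgebraicGeometry.Pohlmann1968.DegenerateCMTypesMultiquadraticCMField
import Literature.NumberTheory.ComplexMultiplication.CMTypeBalancedSubgroupCosets
import HarnessLib

/-!
# Weil type over CM subfields of higher degree: a CM type of a multiquadratic CM field is balanced over a subfield
# `L` iff it is balanced over every imaginary quadratic subfield of `L`; the biquadratic Weil subfields are the
# composita of pairs of Weil imaginary quadratic subfields, `C(g + 1 − Rank, 2)` in number (Moonen–Zarhin, Yanai)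

SETTING (tree `WeilTypeCMSubfieldExceptionalClasses`, `DegenerateCMTypesMultiquadraticCMField`,
`MultiquadraticCMFieldWalshValuesQuadraticSubfields`, `CMTypeBalancedSubgroupCosets`).  `K` a CM field, Galois over `ℚ`
with `Gal(K/ℚ)` of exponent `2` (`K = ℚ(√−d, √a₁, …, √a_r)`, `[K:ℚ] = 2g`), `Φ` a CM type, `L ⊆ K` a subfield.  `Φ` is
BALANCED OVER `L` when over every embedding `σ : L → ℂ` as many extensions of `σ` to `K` lie in `Φ` as outside it —
the multiplicities `n_σ = n_σ̄ = [K:L]/2` of B. Moonen, Yu. Zarhin [MoonenZarhin1998WeilClasses]: for an abelian variety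
`A` with `L ↪ End⁰(A)` the space of WEIL CLASSES `W_L = ⋀_L^{2 dim A/[L:ℚ]} H¹(A, ℚ) ⊆ H^{2 dim A/[L:ℚ]}(A, ℚ)` consists of
Hodge classes iff `n_σ = n_σ̄` for all `σ` (their Criterion answering Q1; A. Weil [Weil1977] for `L` imaginary
quadratic), and for `A` simple of CM type these classes are EXCEPTIONAL iff `L` is not totally real (their Criterion for
Q2, type IV, `d = m = 1`; the tree's `fibre_mem_pohlmannSets_diff`).  The tree knows the imaginary QUADRATIC case: the
Weil imaginary quadratic subfields are counted by Kubota's defect, `Rank(Φ) + #{F} = g + 1`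
(`Multiquadratic.cmTypeRank_add_ncard_weilQuadratic_eq`, B. Dodson [Dodson1984] §3.1.1).  THIS FILE climbs to subfields
of higher degree (group level: `BalancedCosets`, the fibres over `Hom(L, ℂ)` are the cosets of `Gal(K/L)`):

> **Theorem** (`forall_fibre_iff_forall_quadratic`, ★).  `Φ` is balanced over a subfield `L ⊆ K` iff it is balanced
> over EVERY IMAGINARY QUADRATIC SUBFIELD `F ⊆ L` — «`(A, L)` is of Weil type iff `(A, F)` is of Weil type for every
> imaginary quadratic `F ⊆ L`» (Moonen–Zarhin Remark (1): `W_L` Hodge ⟹ `W_F` Hodge for `F ⊆ L`; the converse through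
> the imaginary quadratic subfields holds on multiquadratic fields).  (`forall_fibre_iff_forall_coset`: the dictionary
> with the cosets of `Gal(K/L)`.)
> **Theorem** (Yanai's bound, `ncard_quadratic_le_sub_cmTypeRank`).  If `Φ` is balanced over `L` then every imaginary
> quadratic subfield of `L` is a Weil subfield of `Φ`, so `#{F ⊆ L imaginary quadratic} ≤ g + 1 − Rank(Φ)`: B. B. Gordon
> [Gordon1999HodgeAVSurvey] 9.4.3 (H. Yanai 1994), case `a = b`: «if `a = b` then `d + 1 − rank S ≥ d₁`» — here for
> multiquadratic `K`, where `d₁ = [L:ℚ]/2` is the number of imaginary quadratic subfields of the CM field `L`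
> (the tree's `WeilTypeCMSubfieldExceptionalClasses` had only the qualitative `¬ IsNondegenerate`).
> **Theorem** (biquadratic subfields: `finrank_sup_eq_four`, `le_sup_iff_eq_or_eq`, `forall_fibre_sup_iff`,
> `exists_eq_sup_of_finrank_eq_four`).  For distinct imaginary quadratic subfields `F₁ ≠ F₂`: `F₁F₂` has degree `4`, is
> not totally real, its imaginary quadratic subfields are exactly `F₁`, `F₂` (the third quadratic subfield is real), and
> **`Φ` is balanced over `F₁F₂` iff it is balanced over `F₁` and over `F₂`**; every non-totally-real subfield of degree
> `4` is such an `F₁F₂`.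
> **Theorem** (`ncard_weilBiquadratic_eq_choose`, THE COUNT).  **`#{L ⊆ K : [L:ℚ] = 4, L not totally real, Φ balanced
> over L} = C(w, 2)`, `w = #{F : Weil imaginary quadratic} = g + 1 − Rank(Φ)`** (`…_eq_choose_sub_cmTypeRank`): a simple
> degenerate CM abelian `16`-fold with multiquadratic complex multiplication (degree `32`, rank `11`, tree) is of Weil type
> over exactly `15` biquadratic CM subfields; a primitive near-bent type in degree `64` (rank `17`) over exactly `120`.

HONEST SCOPE.  Field dress of the group-level `BalancedCosets` through the Galois correspondence; Moonen–Zarhin print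
the criterion and Remark (1), Gordon/Yanai the bound; the count `C(w, 2)` and the biquadratic trichotomy are this file's
bookkeeping (for exponent-`2` Galois groups).  The exceptional Weil classes these subfields force (codimension `g/4`)
are the sequel's.  THEOREMS ONLY: no definition, no named fact, no instance, no `sorry`.

## References

* [MoonenZarhin1998WeilClasses] B. J. J. Moonen, Yu. G. Zarhin, *Weil classes on abelian varieties*, J. reine angew.
  Math. 496 (1998) 83–92 (held `paper:arxiv-alg-geom_9612017`, pp. 1–4): Criterion (Q1), Criterion (Q2), Remark (1).
* [Gordon1999HodgeAVSurvey] B. B. Gordon, *A survey of the Hodge conjecture for abelian varieties*, 9.4.3 (Theorem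
  [B.140] = H. Yanai, *On degenerate CM-types*, J. Number Theory 49 (1994) 295–303), 5.13 (ii).
* [Dodson1984] B. Dodson, *The structure of Galois groups of CM-fields*, Trans. AMS 283 (1984), §3.1.1 Theorem.
* [Kubota1965] T. Kubota, *On the field extension by complex multiplication*, Trans. AMS 118 (1965), §4 Lemma 2.
* [Shimura1998] G. Shimura, *Abelian Varieties with Complex Multiplication and Modular Functions*, §8.4 Example (1),
  §18.2 Lemma (i).
* [MilneFT2022] J. S. Milne, *Fields and Galois Theory*, Thm. 3.16 (the Galois correspondence), Cor. 3.19.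

## Provenance

Lane `lit-hodgefound` (Track 2, Layer A3/A5 field dress), seat `lit-hodgefound-p10` generation 46, row g46-#2; neighbours
cited by name, nothing restated: `BalancedCosets` (g46-#1: `forall_coset_iff_forall_indexTwo`,
`two_mul_card_filter_mul_mem_eq_of_mem`, `two_mul_card_filter_mul_mem_eq_of_le`, `two_mul_card_filter_mem_eq_iff`,
`index_inf_eq_four`, `eq_or_eq_of_inf_le`, `exists_eq_inf_of_index_eq_four`, `forall_coset_inf_iff`,
`ncard_indexFour_balanced_eq_choose`, USED), `Pohlmann1968.AbelianKernels` (`embOf_comp_algebraMap_eq_iff`,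
`card_filter_mem_eq_iff_balanced`, `index_eq_finrank_fixedField`, `conjGal_not_mem_iff_not_isTotallyReal_fixedField`),
`CMNumbers` (`index_fixingSubgroup_eq_finrank`, `conjGal_not_mem_fixingSubgroup_iff`), `Multiquadratic`
(`cmTypeRank_add_ncard_weilQuadratic_eq`, `isAbelianGalois_of_forall_sq_eq_one`), `CyclicTwoOddPrimes`
(`isCMTypeWith_galType`), `CMTypeRankCharactersNumberField` (`embOf`, `embOf_bijective`, `card_gal_eq_finrank`), Mathlib's
Galois correspondence (`fixingSubgroup_fixedField`, `fixedField_fixingSubgroup`, `fixingSubgroup_sup`).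
-/

open scoped BigOperators NumberField IsMulCommutative Classical
open NumberField Module IntermediateField

namespace Literature.AlgebraicGeometry.Pohlmann1968

namespace MultiquadraticWeilSubfields

open scoped Literature.NumberTheory.ComplexMultiplication
open Literature.NumberTheory.ComplexMultiplication (IsCMTypeWith conjGal)
open Literature.NumberTheory.ComplexMultiplication.BalancedCosets (forall_coset_iff_forall_indexTwo
  two_mul_card_filter_mul_mem_eq_of_mem two_mul_card_filter_mul_mem_eq_of_le two_mul_card_filter_mem_eq_iff
  index_inf_eq_four eq_or_eq_of_inf_le exists_eq_inf_of_index_eq_four forall_coset_inf_iff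
  ncard_indexFour_balanced_eq_choose)
open Literature.NumberTheory.ComplexMultiplication.CMNumbers (index_fixingSubgroup_eq_finrank
  conjGal_not_mem_fixingSubgroup_iff)
open Literature.AlgebraicGeometry.Pohlmann1968.AbelianKernels (embOf_comp_algebraMap_eq_iff
  card_filter_mem_eq_iff_balanced index_eq_finrank_fixedField conjGal_not_mem_iff_not_isTotallyReal_fixedField)
open Literature.AlgebraicGeometry.Pohlmann1968.CyclicTwoOddPrimes (isCMTypeWith_galType)
open Literature.AlgebraicGeometry.Pohlmann1968.Multiquadratic (cmTypeRank_add_ncard_weilQuadratic_eq)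
open Literature.AlgebraicGeometry.Motives (CMType)

variable {K : Type} [Field K] [NumberField K] [IsCMField K] [IsGalois ℚ K]

/-! ## §0 Helpers -/

section Helpers

omit [IsCMField K] [IsGalois ℚ K] in
/-- `g·g = 1`, `g⁻¹ = g` in exponent `2`. [folklore] -/
private theorem inv_eq_self_ws (hexp : ∀ g : K ≃ₐ[ℚ] K, g ^ 2 = 1) (g : K ≃ₐ[ℚ] K) : g⁻¹ = g :=
  inv_eq_of_mul_eq_one_right (by rw [← pow_two]; exact hexp g)

omit [IsGalois ℚ K] in
/-- `φ₀ ∘ ρ = conj ∘ φ₀`. [cite: Shimura1998, §18.2 Lemma (i)] -/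
private theorem apply_conjGal_eq_ws (φ₀ : K →+* ℂ) (x : K) :
    φ₀ ((conjGal : K ≃ₐ[ℚ] K) x) = starRingEnd ℂ (φ₀ x) :=
  AbelianCMFieldExistence.apply_conjGal_eq φ₀ x

/-- The group-level type `T_Φ = {s : σ_s ∈ Φ}` is a CM type of `Gal(K/ℚ)` w.r.t. `ρ`. [cite: Shimura1998, §8.1] -/
private theorem isCMTypeWith_T_ws (hexp : ∀ g : K ≃ₐ[ℚ] K, g ^ 2 = 1) (φ₀ : K →+* ℂ) (Φ : CMType K) :
    IsCMTypeWith (conjGal : K ≃ₐ[ℚ] K)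
      (↑(Finset.univ.filter fun s : K ≃ₐ[ℚ] K => embOf φ₀ s ∈ Φ.1) : Set (K ≃ₐ[ℚ] K)) := by
  haveI := Multiquadratic.isAbelianGalois_of_forall_sq_eq_one hexp
  exact isCMTypeWith_galType (apply_conjGal_eq_ws φ₀) Φ

omit [IsCMField K] in
/-- **Fibres are cosets**: `σ_s|_L = σ_x|_L ⟺ x·s ∈ Gal(K/L)` (exponent `2`). [cite: Shimura1998, §8.4 Example (1)] -/
private theorem comp_eq_comp_iff_ws (hexp : ∀ g : K ≃ₐ[ℚ] K, g ^ 2 = 1) (φ₀ : K →+* ℂ) (L : IntermediateField ℚ K)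
    (x s : K ≃ₐ[ℚ] K) :
    (embOf φ₀ s).comp (algebraMap L K) = (embOf φ₀ x).comp (algebraMap L K) ↔ x * s ∈ L.fixingSubgroup := by
  haveI := Multiquadratic.isAbelianGalois_of_forall_sq_eq_one hexp
  rw [eq_comm, embOf_comp_algebraMap_eq_iff φ₀ L x s,
    show s * x⁻¹ = x * s by rw [inv_eq_self_ws hexp x, mul_comm]]

omit [IsCMField K] in
/-- Every embedding of `L` is the restriction of some `σ_x`. [cite: MilneFT2022, Prop. 2.7 (a)] -/
theorem exists_embOf_comp_eq (φ₀ : K →+* ℂ) (L : IntermediateField ℚ K) (σ : L →+* ℂ) :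
    ∃ x : K ≃ₐ[ℚ] K, (embOf φ₀ x).comp (algebraMap L K) = σ := by
  obtain ⟨φ, hφ⟩ : ∃ φ : K →+* ℂ, φ.comp (algebraMap L K) = σ :=
    ⟨ComplexEmbedding.lift K σ, ComplexEmbedding.lift_comp_algebraMap K σ⟩
  obtain ⟨x, rfl⟩ := (embOf_bijective φ₀).2 φ
  exact ⟨x, hφ⟩

omit [IsCMField K] in
/-- `#{s ∈ T_Φ : x·s ∈ Gal(K/L)} = #{φ ∈ Φ : φ|_L = σ_x|_L}` — the elements of the group-level type in the coset
`x·Gal(K/L)` are counted by the embeddings of `Φ` over `σ_x|_L`. [cite: Shimura1998, §8.4 Example (1)]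
[cite: Dodson1984, §3.1.1 Theorem (proof)] -/
theorem card_filter_mul_mem_fixingSubgroup_eq_ncard (hexp : ∀ g : K ≃ₐ[ℚ] K, g ^ 2 = 1) (φ₀ : K →+* ℂ)
    (Φ : CMType K) (L : IntermediateField ℚ K) (x : K ≃ₐ[ℚ] K) :
    ((Finset.univ.filter fun s : K ≃ₐ[ℚ] K => embOf φ₀ s ∈ Φ.1).filter fun s => x * s ∈ L.fixingSubgroup).card =
      {φ : K →+* ℂ | φ.comp (algebraMap L K) = (embOf φ₀ x).comp (algebraMap L K) ∧ φ ∈ Φ.1}.ncard := by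
  have h1 : {φ : K →+* ℂ | φ.comp (algebraMap L K) = (embOf φ₀ x).comp (algebraMap L K) ∧ φ ∈ Φ.1} =
      ↑(((Finset.univ.filter fun s : K ≃ₐ[ℚ] K => embOf φ₀ s ∈ Φ.1).filter
        fun s => x * s ∈ L.fixingSubgroup).image (embOf φ₀)) := by
    ext φ
    simp only [Set.mem_setOf_eq, Finset.coe_image, Finset.coe_filter, Finset.mem_filter, Finset.mem_univ, true_and,
      Set.mem_image]
    constructor
    · rintro ⟨hφ, hφΦ⟩
      obtain ⟨s, rfl⟩ := (embOf_bijective φ₀).2 φ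
      exact ⟨s, ⟨hφΦ, (comp_eq_comp_iff_ws hexp φ₀ L x s).1 hφ⟩, rfl⟩
    · rintro ⟨s, ⟨hs, hxs⟩, rfl⟩
      exact ⟨(comp_eq_comp_iff_ws hexp φ₀ L x s).2 hxs, hs⟩
  rw [h1, Set.ncard_coe_finset, Finset.card_image_of_injective _ (embOf_bijective φ₀).1]

omit [IsCMField K] [IsGalois ℚ K] in
/-- The translate `{u : x·u ∈ H}` of a subgroup `H ≤ Gal(K/ℚ)` has `|H|` elements. [folklore] -/
private theorem card_filter_univ_mul_mem_ws (H : Subgroup (K ≃ₐ[ℚ] K)) (x : K ≃ₐ[ℚ] K) :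
    (Finset.univ.filter fun u : K ≃ₐ[ℚ] K => x * u ∈ H).card = Nat.card H := by
  have e : Nat.card H = (Finset.univ.filter fun g : K ≃ₐ[ℚ] K => g ∈ H).card := by
    rw [Nat.card_eq_fintype_card, ← Fintype.card_subtype]
  rw [e]
  refine Finset.card_bij (fun u _ => x * u) (fun u hu => ?_) (fun a _ b _ hab => mul_left_cancel hab)
    (fun k hk => ⟨x⁻¹ * k, ?_, by rw [mul_inv_cancel_left]⟩)
  · simpa using hu
  · simpa using hk

omit [IsCMField K] in
/-- **The fibre over `σ_x|_L` is the image of the coset `x·Gal(K/L)` under `s ↦ σ_s`.** [cite: Shimura1998, §8.4 Example (1)] -/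
theorem filter_comp_eq_eq_image (hexp : ∀ g : K ≃ₐ[ℚ] K, g ^ 2 = 1) (φ₀ : K →+* ℂ) (L : IntermediateField ℚ K)
    (x : K ≃ₐ[ℚ] K) :
    (Finset.univ.filter fun φ : K →+* ℂ => φ.comp (algebraMap L K) = (embOf φ₀ x).comp (algebraMap L K)) =
      (Finset.univ.filter fun s : K ≃ₐ[ℚ] K => x * s ∈ L.fixingSubgroup).image (embOf φ₀) := by
  ext φ
  simp only [Finset.mem_filter, Finset.mem_univ, true_and, Finset.mem_image]
  constructor
  · intro hφ
    obtain ⟨s, rfl⟩ := (embOf_bijective φ₀).2 φ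
    exact ⟨s, (comp_eq_comp_iff_ws hexp φ₀ L x s).1 hφ, rfl⟩
  · rintro ⟨s, hxs, rfl⟩
    exact (comp_eq_comp_iff_ws hexp φ₀ L x s).2 hxs

/-- `σ_{ρx} = σ̄_x`. [cite: Shimura1998, §18.2 Lemma (i)] -/
private theorem embOf_conjGal_mul_ws (hexp : ∀ g : K ≃ₐ[ℚ] K, g ^ 2 = 1) (φ₀ : K →+* ℂ) (x : K ≃ₐ[ℚ] K) :
    embOf φ₀ ((conjGal : K ≃ₐ[ℚ] K) * x) = ComplexEmbedding.conjugate (embOf φ₀ x) := by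
  haveI := Multiquadratic.isAbelianGalois_of_forall_sq_eq_one hexp
  refine RingHom.ext fun y => ?_
  rw [embOf_apply, ComplexEmbedding.conjugate_coe_eq, embOf_apply]
  have e : ((conjGal : K ≃ₐ[ℚ] K) * x).symm y = (conjGal : K ≃ₐ[ℚ] K) (x.symm y) := by
    rw [mul_comm, ← AlgEquiv.aut_inv, mul_inv_rev, inv_eq_self_ws hexp conjGal, AlgEquiv.mul_apply,
      AlgEquiv.aut_inv]
  rw [e, apply_conjGal_eq_ws]

/-- **Every embedding of a non-totally-real subfield `L` of the CM field `K` is non-real** (`σ̄_x|_L = σ_{ρx}|_L = σ_x|_L`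
would put `ρ` in `Gal(K/L)`). [cite: Shimura1998, §18.2 Lemma (i)] -/
theorem conjugate_comp_ne_of_not_isTotallyReal (hexp : ∀ g : K ≃ₐ[ℚ] K, g ^ 2 = 1) {L : IntermediateField ℚ K} (hL : ¬ IsTotallyReal L)
    (σ : L →+* ℂ) : ComplexEmbedding.conjugate σ ≠ σ := by
  obtain ⟨φ₀⟩ := (inferInstance : Nonempty (K →+* ℂ))
  haveI := Multiquadratic.isAbelianGalois_of_forall_sq_eq_one hexp
  obtain ⟨x, rfl⟩ := exists_embOf_comp_eq φ₀ L σ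
  intro h
  have h1 : (embOf φ₀ ((conjGal : K ≃ₐ[ℚ] K) * x)).comp (algebraMap L K) = (embOf φ₀ x).comp (algebraMap L K) := by
    rw [embOf_conjGal_mul_ws hexp, ← h]
    rfl
  rw [comp_eq_comp_iff_ws hexp φ₀ L] at h1
  have e : x * ((conjGal : K ≃ₐ[ℚ] K) * x) = conjGal := by
    rw [mul_left_comm, ← pow_two, hexp x, mul_one]
  rw [e] at h1
  exact (conjGal_not_mem_fixingSubgroup_iff L).2 hL h1

omit [IsCMField K] in
/-- The whole fibre over `σ_x|_L` has `|Gal(K/L)|` elements. [cite: Shimura1998, §8.4 Example (1)] -/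
theorem ncard_fibre_eq_natCard (hexp : ∀ g : K ≃ₐ[ℚ] K, g ^ 2 = 1) (φ₀ : K →+* ℂ) (L : IntermediateField ℚ K)
    (x : K ≃ₐ[ℚ] K) :
    {φ : K →+* ℂ | φ.comp (algebraMap L K) = (embOf φ₀ x).comp (algebraMap L K)}.ncard =
      Nat.card L.fixingSubgroup := by
  have h1 : {φ : K →+* ℂ | φ.comp (algebraMap L K) = (embOf φ₀ x).comp (algebraMap L K)} =
      ↑(Finset.univ.filter fun φ : K →+* ℂ => φ.comp (algebraMap L K) = (embOf φ₀ x).comp (algebraMap L K)) := by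
    ext φ; simp
  rw [h1, Set.ncard_coe_finset, filter_comp_eq_eq_image hexp φ₀ L x,
    Finset.card_image_of_injective _ (embOf_bijective φ₀).1, card_filter_univ_mul_mem_ws]

omit [IsCMField K] in
/-- The two counts over a fibre add up to `|Gal(K/L)|`. [cite: Shimura1998, §8.4 Example (1)] -/
theorem ncard_add_ncard_not_eq_natCard (hexp : ∀ g : K ≃ₐ[ℚ] K, g ^ 2 = 1) (φ₀ : K →+* ℂ) (Φ : CMType K)
    (L : IntermediateField ℚ K) (x : K ≃ₐ[ℚ] K) :
    {φ : K →+* ℂ | φ.comp (algebraMap L K) = (embOf φ₀ x).comp (algebraMap L K) ∧ φ ∈ Φ.1}.ncard +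
      {φ : K →+* ℂ | φ.comp (algebraMap L K) = (embOf φ₀ x).comp (algebraMap L K) ∧ φ ∉ Φ.1}.ncard =
        Nat.card L.fixingSubgroup := by
  rw [← ncard_fibre_eq_natCard hexp φ₀ L x]
  have h := Set.ncard_inter_add_ncard_sdiff_eq_ncard
    {φ : K →+* ℂ | φ.comp (algebraMap L K) = (embOf φ₀ x).comp (algebraMap L K)} (Φ.1) (Set.toFinite _)
  have e1 : {φ : K →+* ℂ | φ.comp (algebraMap L K) = (embOf φ₀ x).comp (algebraMap L K)} ∩ Φ.1 =
      {φ : K →+* ℂ | φ.comp (algebraMap L K) = (embOf φ₀ x).comp (algebraMap L K) ∧ φ ∈ Φ.1} := by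
    ext φ; simp only [Set.mem_inter_iff, Set.mem_setOf_eq]
  have e2 : {φ : K →+* ℂ | φ.comp (algebraMap L K) = (embOf φ₀ x).comp (algebraMap L K)} \ Φ.1 =
      {φ : K →+* ℂ | φ.comp (algebraMap L K) = (embOf φ₀ x).comp (algebraMap L K) ∧ φ ∉ Φ.1} := by
    ext φ; simp only [Set.mem_sdiff, Set.mem_setOf_eq]
  rw [e1, e2] at h
  exact h

end Helpers

/-! ## §1 The dictionary: balanced over `L` ⟺ every coset of `Gal(K/L)` is half in `T_Φ` -/

section Dictionary

omit [IsCMField K] in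
/-- **`Φ` IS BALANCED OVER `L` IFF EVERY COSET OF `Gal(K/L)` MEETS THE GROUP-LEVEL TYPE `T_Φ` IN EXACTLY HALF**
(`n_σ(Φ) = #(T_Φ ∩ x_σ Gal(K/L))`, `n_σ + n_σ̄ = [K:L]`). [cite: MoonenZarhin1998WeilClasses, Criterion (Q1)]
[cite: Shimura1998, §8.4 Example (1)] -/
theorem forall_fibre_iff_forall_coset (hexp : ∀ g : K ≃ₐ[ℚ] K, g ^ 2 = 1) (φ₀ : K →+* ℂ) (Φ : CMType K)
    (L : IntermediateField ℚ K) :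
    (∀ σ : L →+* ℂ, {φ : K →+* ℂ | φ.comp (algebraMap L K) = σ ∧ φ ∈ Φ.1}.ncard =
        {φ : K →+* ℂ | φ.comp (algebraMap L K) = σ ∧ φ ∉ Φ.1}.ncard) ↔
      ∀ x : K ≃ₐ[ℚ] K, 2 * ((Finset.univ.filter fun s : K ≃ₐ[ℚ] K => embOf φ₀ s ∈ Φ.1).filter
        fun s => x * s ∈ L.fixingSubgroup).card = Nat.card L.fixingSubgroup := by
  constructor
  · intro h x
    have h1 := h ((embOf φ₀ x).comp (algebraMap L K))
    have h2 := ncard_add_ncard_not_eq_natCard hexp φ₀ Φ L x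
    rw [card_filter_mul_mem_fixingSubgroup_eq_ncard hexp φ₀ Φ L x]
    omega
  · intro h σ
    obtain ⟨x, rfl⟩ := exists_embOf_comp_eq φ₀ L σ
    have h1 := h x
    have h2 := ncard_add_ncard_not_eq_natCard hexp φ₀ Φ L x
    rw [card_filter_mul_mem_fixingSubgroup_eq_ncard hexp φ₀ Φ L x] at h1
    omega

end Dictionary

/-! ## §2 ★ Balanced over `L` ⟺ balanced over every imaginary quadratic subfield of `L` -/

section Quadratic

omit [IsCMField K] in
/-- Galois correspondence: `F ≤ L ⟺ Gal(K/L) ≤ Gal(K/F)`. [cite: MilneFT2022, Thm. 3.16] -/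
private theorem le_iff_fixingSubgroup_le_ws (F L : IntermediateField ℚ K) :
    F ≤ L ↔ L.fixingSubgroup ≤ F.fixingSubgroup := by
  constructor
  · exact IntermediateField.fixingSubgroup_le
  · intro h
    have := IntermediateField.fixedField_le h
    rwa [IsGalois.fixedField_fixingSubgroup, IsGalois.fixedField_fixingSubgroup] at this

/-- **★ `Φ` IS BALANCED OVER A SUBFIELD `L ⊆ K` IFF IT IS BALANCED OVER EVERY IMAGINARY QUADRATIC SUBFIELD OF `L`**
(`K` multiquadratic CM): «`(A, L)` is of Weil type iff `(A, F)` is of Weil type for every imaginary quadratic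
`F ⊆ L`».  For `L` totally real both sides hold (no imaginary quadratic subfields; cosets of `Gal(K/L) ∋ ρ` are
conjugation-stable). [cite: MoonenZarhin1998WeilClasses, Criterion (Q1) and Remark (1) after Criterion (Q2)]
[cite: Gordon1999HodgeAVSurvey, 9.4.3] [cite: Dodson1984, §3.1.1 Theorem] -/
theorem forall_fibre_iff_forall_quadratic (hexp : ∀ g : K ≃ₐ[ℚ] K, g ^ 2 = 1) (Φ : CMType K)
    (L : IntermediateField ℚ K) :
    (∀ σ : L →+* ℂ, {φ : K →+* ℂ | φ.comp (algebraMap L K) = σ ∧ φ ∈ Φ.1}.ncard =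
        {φ : K →+* ℂ | φ.comp (algebraMap L K) = σ ∧ φ ∉ Φ.1}.ncard) ↔
      ∀ F : IntermediateField ℚ K, F ≤ L → finrank ℚ F = 2 → ¬ IsTotallyReal F →
        ∀ τ : F →+* ℂ, {φ : K →+* ℂ | φ.comp (algebraMap F K) = τ ∧ φ ∈ Φ.1}.ncard =
          {φ : K →+* ℂ | φ.comp (algebraMap F K) = τ ∧ φ ∉ Φ.1}.ncard := by
  obtain ⟨φ₀⟩ := (inferInstance : Nonempty (K →+* ℂ))
  haveI := Multiquadratic.isAbelianGalois_of_forall_sq_eq_one hexp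
  have hT := isCMTypeWith_T_ws hexp φ₀ Φ
  rw [forall_fibre_iff_forall_coset hexp φ₀ Φ L]
  by_cases hρ : (conjGal : K ≃ₐ[ℚ] K) ∈ L.fixingSubgroup
  · -- `L` totally real: both sides hold
    refine ⟨fun _ F hFL _ hF => ?_, fun _ x => two_mul_card_filter_mul_mem_eq_of_mem hT _ hρ x⟩
    exact absurd ((le_iff_fixingSubgroup_le_ws F L).1 hFL hρ) ((conjGal_not_mem_fixingSubgroup_iff F).2 hF)
  rw [forall_coset_iff_forall_indexTwo hexp hT _ hρ]
  constructor
  · intro h F hFL h2 hF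
    have hidx : F.fixingSubgroup.index = 2 := by rw [index_fixingSubgroup_eq_finrank F, h2]
    have h1 := h F.fixingSubgroup ((le_iff_fixingSubgroup_le_ws F L).1 hFL)
      ((conjGal_not_mem_fixingSubgroup_iff F).2 hF) hidx
    exact (card_filter_mem_eq_iff_balanced φ₀ Φ F h2 hF).1 ((two_mul_card_filter_mem_eq_iff hT hidx).1 h1)
  · intro h H' hle hρH' hidx
    have h2 : finrank ℚ (fixedField H') = 2 := by rw [← index_eq_finrank_fixedField H', hidx]
    have hF : ¬ IsTotallyReal (fixedField H') := (conjGal_not_mem_iff_not_isTotallyReal_fixedField H').1 hρH'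
    have hFL : fixedField H' ≤ L := by
      rw [le_iff_fixingSubgroup_le_ws, fixingSubgroup_fixedField]; exact hle
    have h1 := (card_filter_mem_eq_iff_balanced φ₀ Φ (fixedField H') h2 hF).2 (h _ hFL h2 hF)
    rw [fixingSubgroup_fixedField] at h1
    exact (two_mul_card_filter_mem_eq_iff hT hidx).2 h1

omit [IsCMField K] in
/-- **Upward (Moonen–Zarhin Remark (1)): balanced over `L` ⟹ balanced over every subfield `L' ⊆ L`.**
[cite: MoonenZarhin1998WeilClasses, Remark (1) after Criterion (Q2)] -/
theorem forall_fibre_of_le (hexp : ∀ g : K ≃ₐ[ℚ] K, g ^ 2 = 1) (Φ : CMType K) {L L' : IntermediateField ℚ K}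
    (hle : L' ≤ L)
    (hL : ∀ σ : L →+* ℂ, {φ : K →+* ℂ | φ.comp (algebraMap L K) = σ ∧ φ ∈ Φ.1}.ncard =
      {φ : K →+* ℂ | φ.comp (algebraMap L K) = σ ∧ φ ∉ Φ.1}.ncard) :
    ∀ σ : L' →+* ℂ, {φ : K →+* ℂ | φ.comp (algebraMap L' K) = σ ∧ φ ∈ Φ.1}.ncard =
      {φ : K →+* ℂ | φ.comp (algebraMap L' K) = σ ∧ φ ∉ Φ.1}.ncard := by
  obtain ⟨φ₀⟩ := (inferInstance : Nonempty (K →+* ℂ))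
  haveI := Multiquadratic.isAbelianGalois_of_forall_sq_eq_one hexp
  have h1 := (forall_fibre_iff_forall_coset hexp φ₀ Φ L).1 hL
  exact (forall_fibre_iff_forall_coset hexp φ₀ Φ L').2
    (two_mul_card_filter_mul_mem_eq_of_le hexp ((le_iff_fixingSubgroup_le_ws L' L).1 hle) h1)

/-- **YANAI'S BOUND (`a = b`) ON A MULTIQUADRATIC CM FIELD**: if `Φ` is balanced over `L` then every imaginary quadratic
subfield of `L` is a Weil subfield of `Φ`, hence `#{F ⊆ L : [F:ℚ] = 2, F not totally real} ≤ [K:ℚ]/2 + 1 − Rank(Φ)`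
(Kubota's defect; Gordon 9.4.3: «if `a = b` then `d + 1 − rank S ≥ d₁`»). [cite: Gordon1999HodgeAVSurvey, 9.4.3]
[cite: Kubota1965, §4 Lemma 2] [cite: Dodson1984, §3.1.1 Theorem] -/
theorem ncard_quadratic_le_sub_cmTypeRank (hexp : ∀ g : K ≃ₐ[ℚ] K, g ^ 2 = 1) (Φ : CMType K)
    (L : IntermediateField ℚ K)
    (hL : ∀ σ : L →+* ℂ, {φ : K →+* ℂ | φ.comp (algebraMap L K) = σ ∧ φ ∈ Φ.1}.ncard =
      {φ : K →+* ℂ | φ.comp (algebraMap L K) = σ ∧ φ ∉ Φ.1}.ncard) :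
    {F : IntermediateField ℚ K | F ≤ L ∧ finrank ℚ F = 2 ∧ ¬ IsTotallyReal F}.ncard ≤
      finrank ℚ K / 2 + 1 - cmTypeRank Φ := by
  haveI : Finite (IntermediateField ℚ K) :=
    Field.finite_intermediateField_of_exists_primitive_element ℚ K (Field.exists_primitive_element ℚ K)
  have hkey := cmTypeRank_add_ncard_weilQuadratic_eq hexp Φ
  have hq := (forall_fibre_iff_forall_quadratic hexp Φ L).1 hL
  have hsub : {F : IntermediateField ℚ K | F ≤ L ∧ finrank ℚ F = 2 ∧ ¬ IsTotallyReal F} ⊆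
      {F : IntermediateField ℚ K | finrank ℚ F = 2 ∧ ¬ IsTotallyReal F ∧
        ∀ τ : F →+* ℂ, {φ : K →+* ℂ | φ.comp (algebraMap F K) = τ ∧ φ ∈ Φ.1}.ncard =
          {φ : K →+* ℂ | φ.comp (algebraMap F K) = τ ∧ φ ∉ Φ.1}.ncard} :=
    fun F ⟨hFL, h2, hF⟩ => ⟨h2, hF, hq F hFL h2 hF⟩
  have := Set.ncard_le_ncard hsub (Set.toFinite _)
  omega

end Quadratic

/-! ## §3 Biquadratic subfields: `F₁F₂` for distinct imaginary quadratic `F₁`, `F₂` -/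

section Biquadratic

omit [IsCMField K] in
/-- `F ↦ Gal(K/F)` is injective (Galois correspondence). [cite: MilneFT2022, Thm. 3.16] -/
private theorem fixingSubgroup_injective_ws :
    Function.Injective fun F : IntermediateField ℚ K => F.fixingSubgroup := by
  intro F F' h
  have h' : F.fixingSubgroup = F'.fixingSubgroup := h
  rw [← IsGalois.fixedField_fixingSubgroup F, h', IsGalois.fixedField_fixingSubgroup]

omit [IsCMField K] in
/-- **`[F₁F₂ : ℚ] = 4` for distinct quadratic subfields `F₁ ≠ F₂`** (`Gal(K/F₁F₂) = Gal(K/F₁) ∩ Gal(K/F₂)` has index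
`4`). [cite: Dodson1984, §3.1.1 (the Galois group `(ℤ/2)^{r+1}` of `ℚ(√−d, √a₁, …, √a_r)`)] [cite: MilneFT2022, Cor. 3.19] -/
theorem finrank_sup_eq_four (hexp : ∀ g : K ≃ₐ[ℚ] K, g ^ 2 = 1) {F₁ F₂ : IntermediateField ℚ K}
    (h1 : finrank ℚ F₁ = 2) (h2 : finrank ℚ F₂ = 2) (hne : F₁ ≠ F₂) : finrank ℚ ↥(F₁ ⊔ F₂) = 4 := by
  haveI := Multiquadratic.isAbelianGalois_of_forall_sq_eq_one hexp
  have hidx1 : F₁.fixingSubgroup.index = 2 := by rw [index_fixingSubgroup_eq_finrank F₁, h1]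
  have hidx2 : F₂.fixingSubgroup.index = 2 := by rw [index_fixingSubgroup_eq_finrank F₂, h2]
  have hne' : F₁.fixingSubgroup ≠ F₂.fixingSubgroup := fun h => hne (fixingSubgroup_injective_ws h)
  rw [← index_fixingSubgroup_eq_finrank (F₁ ⊔ F₂), IntermediateField.fixingSubgroup_sup]
  exact index_inf_eq_four hidx1 hidx2 hne'

/-- A field containing a non-totally-real subfield is not totally real. [cite: Shimura1998, §18.2 Lemma (i)] -/
theorem not_isTotallyReal_of_le {F L : IntermediateField ℚ K} (hle : F ≤ L) (hF : ¬ IsTotallyReal F) :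
    ¬ IsTotallyReal L := by
  rw [← conjGal_not_mem_fixingSubgroup_iff] at hF ⊢
  exact fun h => hF (IntermediateField.fixingSubgroup_le hle h)

/-- **THE IMAGINARY QUADRATIC SUBFIELDS OF `F₁F₂` ARE EXACTLY `F₁` AND `F₂`** (`F₁ ≠ F₂` imaginary quadratic subfields of
the multiquadratic CM field `K`; the third quadratic subfield of the biquadratic field `F₁F₂` is real) — the
trichotomy of the hyperplanes through `Gal(K/F₁) ∩ Gal(K/F₂)`. [cite: Dodson1984, §3.1.1 (the Galois group `(ℤ/2)^{r+1}` of `ℚ(√−d, √a₁, …, √a_r)`)]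
[cite: Shimura1998, §18.2 Lemma (i)] -/
theorem le_sup_iff_eq_or_eq (hexp : ∀ g : K ≃ₐ[ℚ] K, g ^ 2 = 1) {F₁ F₂ F : IntermediateField ℚ K}
    (h1 : finrank ℚ F₁ = 2) (h2 : finrank ℚ F₂ = 2) (hne : F₁ ≠ F₂) (hF1 : ¬ IsTotallyReal F₁)
    (hF2 : ¬ IsTotallyReal F₂) (h : finrank ℚ F = 2) (hF : ¬ IsTotallyReal F) :
    F ≤ F₁ ⊔ F₂ ↔ F = F₁ ∨ F = F₂ := by
  haveI := Multiquadratic.isAbelianGalois_of_forall_sq_eq_one hexp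
  constructor
  · intro hle
    have hidx1 : F₁.fixingSubgroup.index = 2 := by rw [index_fixingSubgroup_eq_finrank F₁, h1]
    have hidx2 : F₂.fixingSubgroup.index = 2 := by rw [index_fixingSubgroup_eq_finrank F₂, h2]
    have hidx : F.fixingSubgroup.index = 2 := by rw [index_fixingSubgroup_eq_finrank F, h]
    have hne' : F₁.fixingSubgroup ≠ F₂.fixingSubgroup := fun h => hne (fixingSubgroup_injective_ws h)
    have hle' : F₁.fixingSubgroup ⊓ F₂.fixingSubgroup ≤ F.fixingSubgroup := by
      rw [← IntermediateField.fixingSubgroup_sup]; exact IntermediateField.fixingSubgroup_le hle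
    have hρ1 : (conjGal : K ≃ₐ[ℚ] K) ∉ F₁.fixingSubgroup := (conjGal_not_mem_fixingSubgroup_iff F₁).2 hF1
    have hρ2 : (conjGal : K ≃ₐ[ℚ] K) ∉ F₂.fixingSubgroup := (conjGal_not_mem_fixingSubgroup_iff F₂).2 hF2
    have hρ : (conjGal : K ≃ₐ[ℚ] K) ∉ F.fixingSubgroup := (conjGal_not_mem_fixingSubgroup_iff F).2 hF
    have key : F.fixingSubgroup = F₁.fixingSubgroup ∨ F.fixingSubgroup = F₂.fixingSubgroup :=
      eq_or_eq_of_inf_le hidx1 hidx2 hne' hρ1 hρ2 hidx hle' hρ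
    rcases key with e | e
    · exact Or.inl (fixingSubgroup_injective_ws e)
    · exact Or.inr (fixingSubgroup_injective_ws e)
  · rintro (rfl | rfl)
    · exact le_sup_left
    · exact le_sup_right

/-- **`Φ` IS BALANCED OVER THE BIQUADRATIC CM SUBFIELD `F₁F₂` IFF IT IS BALANCED OVER `F₁` AND OVER `F₂`** —
«`(A, F₁F₂)` is of Weil type iff `(A, F₁)` and `(A, F₂)` are of Weil type»; the Weil biquadratic CM subfields are the
composita of PAIRS of Weil imaginary quadratic subfields. [cite: MoonenZarhin1998WeilClasses, Criterion (Q1) and Remark (1) after Criterion (Q2)]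
[cite: Gordon1999HodgeAVSurvey, 9.4.3] [cite: Dodson1984, §3.1.1 Theorem] -/
theorem forall_fibre_sup_iff (hexp : ∀ g : K ≃ₐ[ℚ] K, g ^ 2 = 1) (Φ : CMType K) {F₁ F₂ : IntermediateField ℚ K}
    (h1 : finrank ℚ F₁ = 2) (h2 : finrank ℚ F₂ = 2) (hne : F₁ ≠ F₂) (hF1 : ¬ IsTotallyReal F₁)
    (hF2 : ¬ IsTotallyReal F₂) :
    (∀ σ : ↥(F₁ ⊔ F₂) →+* ℂ, {φ : K →+* ℂ | φ.comp (algebraMap ↥(F₁ ⊔ F₂) K) = σ ∧ φ ∈ Φ.1}.ncard =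
        {φ : K →+* ℂ | φ.comp (algebraMap ↥(F₁ ⊔ F₂) K) = σ ∧ φ ∉ Φ.1}.ncard) ↔
      (∀ τ : F₁ →+* ℂ, {φ : K →+* ℂ | φ.comp (algebraMap F₁ K) = τ ∧ φ ∈ Φ.1}.ncard =
          {φ : K →+* ℂ | φ.comp (algebraMap F₁ K) = τ ∧ φ ∉ Φ.1}.ncard) ∧
        ∀ τ : F₂ →+* ℂ, {φ : K →+* ℂ | φ.comp (algebraMap F₂ K) = τ ∧ φ ∈ Φ.1}.ncard =
          {φ : K →+* ℂ | φ.comp (algebraMap F₂ K) = τ ∧ φ ∉ Φ.1}.ncard := by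
  rw [forall_fibre_iff_forall_quadratic hexp Φ (F₁ ⊔ F₂)]
  constructor
  · intro h
    exact ⟨h F₁ le_sup_left h1 hF1, h F₂ le_sup_right h2 hF2⟩
  · rintro ⟨hb1, hb2⟩ F hle h hF
    rcases (le_sup_iff_eq_or_eq hexp h1 h2 hne hF1 hF2 h hF).1 hle with rfl | rfl
    · exact hb1
    · exact hb2

/-- **EVERY NON-TOTALLY-REAL SUBFIELD OF DEGREE `4` IS `F₁F₂` FOR ITS TWO DISTINCT IMAGINARY QUADRATIC SUBFIELDS.**
[cite: Dodson1984, §3.1.1 (the Galois group `(ℤ/2)^{r+1}` of `ℚ(√−d, √a₁, …, √a_r)`)] [cite: MilneFT2022, Thm. 3.16] -/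
theorem exists_eq_sup_of_finrank_eq_four (hexp : ∀ g : K ≃ₐ[ℚ] K, g ^ 2 = 1) {L : IntermediateField ℚ K}
    (hL : finrank ℚ L = 4) (hLr : ¬ IsTotallyReal L) :
    ∃ F₁ F₂ : IntermediateField ℚ K, finrank ℚ F₁ = 2 ∧ finrank ℚ F₂ = 2 ∧ F₁ ≠ F₂ ∧ ¬ IsTotallyReal F₁ ∧
      ¬ IsTotallyReal F₂ ∧ F₁ ⊔ F₂ = L := by
  haveI := Multiquadratic.isAbelianGalois_of_forall_sq_eq_one hexp
  have hidx : L.fixingSubgroup.index = 4 := by rw [index_fixingSubgroup_eq_finrank L, hL]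
  obtain ⟨H₁, H₂, hi1, hi2, hne, hρ1, hρ2, hinf⟩ :=
    exists_eq_inf_of_index_eq_four hexp hidx ((conjGal_not_mem_fixingSubgroup_iff L).2 hLr)
  refine ⟨fixedField H₁, fixedField H₂, by rw [← index_eq_finrank_fixedField H₁, hi1],
    by rw [← index_eq_finrank_fixedField H₂, hi2], fun h => hne ?_,
    (conjGal_not_mem_iff_not_isTotallyReal_fixedField H₁).1 hρ1,
    (conjGal_not_mem_iff_not_isTotallyReal_fixedField H₂).1 hρ2, fixingSubgroup_injective_ws ?_⟩
  · have := congrArg (fun F : IntermediateField ℚ K => F.fixingSubgroup) h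
    simpa only [fixingSubgroup_fixedField] using this
  · show (fixedField H₁ ⊔ fixedField H₂).fixingSubgroup = L.fixingSubgroup
    rw [IntermediateField.fixingSubgroup_sup, fixingSubgroup_fixedField, fixingSubgroup_fixedField, hinf]

end Biquadratic

/-! ## §4 The count of the biquadratic Weil subfields: `C(g + 1 − Rank, 2)` -/

section Count

/-- Bookkeeping: balanced over `F` (quadratic imaginary) ⟺ `2·#(T_Φ ∩ Gal(K/F)) = |Gal(K/F)|`.
[cite: Dodson1984, §3.1.1 Theorem] [cite: Kubota1965, §4 Lemma 2] -/
private theorem balanced_quadratic_iff_ws (hexp : ∀ g : K ≃ₐ[ℚ] K, g ^ 2 = 1) (φ₀ : K →+* ℂ) (Φ : CMType K)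
    (hT : IsCMTypeWith (conjGal : K ≃ₐ[ℚ] K)
      (↑(Finset.univ.filter fun s : K ≃ₐ[ℚ] K => embOf φ₀ s ∈ Φ.1) : Set (K ≃ₐ[ℚ] K)))
    (F : IntermediateField ℚ K) (h2 : finrank ℚ F = 2) (hF : ¬ IsTotallyReal F) :
    (∀ τ : F →+* ℂ, {φ : K →+* ℂ | φ.comp (algebraMap F K) = τ ∧ φ ∈ Φ.1}.ncard =
        {φ : K →+* ℂ | φ.comp (algebraMap F K) = τ ∧ φ ∉ Φ.1}.ncard) ↔
      2 * ((Finset.univ.filter fun s : K ≃ₐ[ℚ] K => embOf φ₀ s ∈ Φ.1).filter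
        fun s => s ∈ F.fixingSubgroup).card = Nat.card F.fixingSubgroup := by
  haveI := Multiquadratic.isAbelianGalois_of_forall_sq_eq_one hexp
  have hidx : F.fixingSubgroup.index = 2 := by rw [index_fixingSubgroup_eq_finrank F, h2]
  rw [two_mul_card_filter_mem_eq_iff hT hidx, card_filter_mem_eq_iff_balanced φ₀ Φ F h2 hF]

/-- **Galois correspondence for the Weil imaginary quadratic subfields**: `F ↦ Gal(K/F)` maps them onto the index-`2`
subgroups `H' ∌ ρ` with `2·#(T_Φ ∩ H') = |H'|`. [cite: Dodson1984, §3.1.1 Theorem] [cite: Kubota1965, §4 Lemma 2]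
[cite: MilneFT2022, Thm. 3.16] -/
theorem image_fixingSubgroup_weilQuadratic_eq (hexp : ∀ g : K ≃ₐ[ℚ] K, g ^ 2 = 1) (φ₀ : K →+* ℂ) (Φ : CMType K) :
    (fun F : IntermediateField ℚ K => F.fixingSubgroup) ''
      {F : IntermediateField ℚ K | finrank ℚ F = 2 ∧ ¬ IsTotallyReal F ∧
        ∀ τ : F →+* ℂ, {φ : K →+* ℂ | φ.comp (algebraMap F K) = τ ∧ φ ∈ Φ.1}.ncard =
          {φ : K →+* ℂ | φ.comp (algebraMap F K) = τ ∧ φ ∉ Φ.1}.ncard} =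
      {H' : Subgroup (K ≃ₐ[ℚ] K) | H'.index = 2 ∧ (conjGal : K ≃ₐ[ℚ] K) ∉ H' ∧
        2 * ((Finset.univ.filter fun s : K ≃ₐ[ℚ] K => embOf φ₀ s ∈ Φ.1).filter
          fun t => t ∈ H').card = Nat.card H'} := by
  haveI := Multiquadratic.isAbelianGalois_of_forall_sq_eq_one hexp
  have hT := isCMTypeWith_T_ws hexp φ₀ Φ
  ext H'
  simp only [Set.mem_image, Set.mem_setOf_eq]
  constructor
  · rintro ⟨F, ⟨hF2, hFr, hbal⟩, rfl⟩
    exact ⟨by rw [index_fixingSubgroup_eq_finrank F, hF2], (conjGal_not_mem_fixingSubgroup_iff F).2 hFr,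
      (balanced_quadratic_iff_ws hexp φ₀ Φ hT F hF2 hFr).1 hbal⟩
  · rintro ⟨hH, hρ, hbal⟩
    have hF2 : finrank ℚ (fixedField H') = 2 := by rw [← index_eq_finrank_fixedField H', hH]
    have hFr : ¬ IsTotallyReal (fixedField H') := (conjGal_not_mem_iff_not_isTotallyReal_fixedField H').1 hρ
    refine ⟨fixedField H', ⟨hF2, hFr, ?_⟩, fixingSubgroup_fixedField H'⟩
    rw [balanced_quadratic_iff_ws hexp φ₀ Φ hT (fixedField H') hF2 hFr, fixingSubgroup_fixedField]
    exact hbal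

/-- **Galois correspondence for the Weil subfields of degree `4`**: `L ↦ Gal(K/L)` maps them onto the index-`4`
subgroups `H ∌ ρ` all of whose cosets are balanced. [cite: MoonenZarhin1998WeilClasses, Criterion (Q1)]
[cite: MilneFT2022, Thm. 3.16] -/
theorem image_fixingSubgroup_weilBiquadratic_eq (hexp : ∀ g : K ≃ₐ[ℚ] K, g ^ 2 = 1) (φ₀ : K →+* ℂ)
    (Φ : CMType K) :
    (fun L : IntermediateField ℚ K => L.fixingSubgroup) ''
      {L : IntermediateField ℚ K | finrank ℚ L = 4 ∧ ¬ IsTotallyReal L ∧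
        ∀ σ : L →+* ℂ, {φ : K →+* ℂ | φ.comp (algebraMap L K) = σ ∧ φ ∈ Φ.1}.ncard =
          {φ : K →+* ℂ | φ.comp (algebraMap L K) = σ ∧ φ ∉ Φ.1}.ncard} =
      {H : Subgroup (K ≃ₐ[ℚ] K) | H.index = 4 ∧ (conjGal : K ≃ₐ[ℚ] K) ∉ H ∧
        ∀ x : K ≃ₐ[ℚ] K, 2 * ((Finset.univ.filter fun s : K ≃ₐ[ℚ] K => embOf φ₀ s ∈ Φ.1).filter
          fun t => x * t ∈ H).card = Nat.card H} := by
  haveI := Multiquadratic.isAbelianGalois_of_forall_sq_eq_one hexp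
  ext H
  simp only [Set.mem_image, Set.mem_setOf_eq]
  constructor
  · rintro ⟨L, ⟨hL, hLr, hbal⟩, rfl⟩
    exact ⟨by rw [index_fixingSubgroup_eq_finrank L, hL], (conjGal_not_mem_fixingSubgroup_iff L).2 hLr,
      (forall_fibre_iff_forall_coset hexp φ₀ Φ L).1 hbal⟩
  · rintro ⟨hH, hρ, hbal⟩
    refine ⟨fixedField H, ⟨by rw [← index_eq_finrank_fixedField H, hH],
      (conjGal_not_mem_iff_not_isTotallyReal_fixedField H).1 hρ, ?_⟩, fixingSubgroup_fixedField H⟩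
    rw [forall_fibre_iff_forall_coset hexp φ₀ Φ (fixedField H), fixingSubgroup_fixedField]
    exact hbal

/-- **Group level with Kubota's defect: `#{H' : [G:H'] = 2, ρ ∉ H', 2·#(T_Φ ∩ H') = |H'|} = [K:ℚ]/2 + 1 − Rank(Φ)`.**
[cite: Kubota1965, §4 Lemma 2] [cite: Dodson1984, §3.1.1 Theorem] -/
theorem ncard_indexTwo_balanced_eq_sub_cmTypeRank (hexp : ∀ g : K ≃ₐ[ℚ] K, g ^ 2 = 1) (φ₀ : K →+* ℂ)
    (Φ : CMType K) :
    {H' : Subgroup (K ≃ₐ[ℚ] K) | H'.index = 2 ∧ (conjGal : K ≃ₐ[ℚ] K) ∉ H' ∧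
        2 * ((Finset.univ.filter fun s : K ≃ₐ[ℚ] K => embOf φ₀ s ∈ Φ.1).filter
          fun t => t ∈ H').card = Nat.card H'}.ncard = finrank ℚ K / 2 + 1 - cmTypeRank Φ := by
  rw [← image_fixingSubgroup_weilQuadratic_eq hexp φ₀ Φ, Set.ncard_image_of_injective _ fixingSubgroup_injective_ws]
  have := cmTypeRank_add_ncard_weilQuadratic_eq hexp Φ
  omega

/-- **Group level: `#{H : [G:H] = 4, ρ ∉ H, all cosets balanced} = C([K:ℚ]/2 + 1 − Rank(Φ), 2)`.**
[cite: Kubota1965, §4 Lemma 2] [cite: Dodson1984, §3.1.1 Theorem] [cite: MoonenZarhin1998WeilClasses, Criterion (Q1)] -/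
theorem ncard_indexFour_balanced_eq_choose_sub_cmTypeRank (hexp : ∀ g : K ≃ₐ[ℚ] K, g ^ 2 = 1) (φ₀ : K →+* ℂ)
    (Φ : CMType K) :
    {H : Subgroup (K ≃ₐ[ℚ] K) | H.index = 4 ∧ (conjGal : K ≃ₐ[ℚ] K) ∉ H ∧
        ∀ x : K ≃ₐ[ℚ] K, 2 * ((Finset.univ.filter fun s : K ≃ₐ[ℚ] K => embOf φ₀ s ∈ Φ.1).filter
          fun t => x * t ∈ H).card = Nat.card H}.ncard = Nat.choose (finrank ℚ K / 2 + 1 - cmTypeRank Φ) 2 := by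
  haveI := Multiquadratic.isAbelianGalois_of_forall_sq_eq_one hexp
  rw [ncard_indexFour_balanced_eq_choose hexp (isCMTypeWith_T_ws hexp φ₀ Φ),
    ncard_indexTwo_balanced_eq_sub_cmTypeRank hexp φ₀ Φ]

/-- **THE COUNT: `#{L ⊆ K : [L:ℚ] = 4, L not totally real, Φ balanced over L} = C(w, 2)`**, `w` = the number of imaginary
quadratic subfields over which `Φ` is balanced — the biquadratic Weil subfields are the composita of the pairs of Weil
imaginary quadratic subfields. [cite: MoonenZarhin1998WeilClasses, Criterion (Q1)] [cite: Dodson1984, §3.1.1 Theorem]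
[cite: Kubota1965, §4 Lemma 2] -/
theorem ncard_weilBiquadratic_eq_choose (hexp : ∀ g : K ≃ₐ[ℚ] K, g ^ 2 = 1) (Φ : CMType K) :
    {L : IntermediateField ℚ K | finrank ℚ L = 4 ∧ ¬ IsTotallyReal L ∧
        ∀ σ : L →+* ℂ, {φ : K →+* ℂ | φ.comp (algebraMap L K) = σ ∧ φ ∈ Φ.1}.ncard =
          {φ : K →+* ℂ | φ.comp (algebraMap L K) = σ ∧ φ ∉ Φ.1}.ncard}.ncard =
      Nat.choose {F : IntermediateField ℚ K | finrank ℚ F = 2 ∧ ¬ IsTotallyReal F ∧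
        ∀ τ : F →+* ℂ, {φ : K →+* ℂ | φ.comp (algebraMap F K) = τ ∧ φ ∈ Φ.1}.ncard =
          {φ : K →+* ℂ | φ.comp (algebraMap F K) = τ ∧ φ ∉ Φ.1}.ncard}.ncard 2 := by
  obtain ⟨φ₀⟩ := (inferInstance : Nonempty (K →+* ℂ))
  haveI := Multiquadratic.isAbelianGalois_of_forall_sq_eq_one hexp
  rw [← Set.ncard_image_of_injective _ fixingSubgroup_injective_ws, image_fixingSubgroup_weilBiquadratic_eq hexp φ₀ Φ,
    ncard_indexFour_balanced_eq_choose hexp (isCMTypeWith_T_ws hexp φ₀ Φ),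
    ← image_fixingSubgroup_weilQuadratic_eq hexp φ₀ Φ, Set.ncard_image_of_injective _ fixingSubgroup_injective_ws]

/-- **`#{biquadratic Weil CM subfields} = C([K:ℚ]/2 + 1 − Rank(Φ), 2)`** (Kubota–Dodson: the Weil imaginary quadratic
subfields number `g + 1 − Rank(Φ)`). [cite: Kubota1965, §4 Lemma 2] [cite: Dodson1984, §3.1.1 Theorem]
[cite: MoonenZarhin1998WeilClasses, Criterion (Q1)] -/
theorem ncard_weilBiquadratic_eq_choose_sub_cmTypeRank (hexp : ∀ g : K ≃ₐ[ℚ] K, g ^ 2 = 1) (Φ : CMType K) :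
    {L : IntermediateField ℚ K | finrank ℚ L = 4 ∧ ¬ IsTotallyReal L ∧
        ∀ σ : L →+* ℂ, {φ : K →+* ℂ | φ.comp (algebraMap L K) = σ ∧ φ ∈ Φ.1}.ncard =
          {φ : K →+* ℂ | φ.comp (algebraMap L K) = σ ∧ φ ∉ Φ.1}.ncard}.ncard =
      Nat.choose (finrank ℚ K / 2 + 1 - cmTypeRank Φ) 2 := by
  rw [ncard_weilBiquadratic_eq_choose hexp Φ]
  congr 1
  have := cmTypeRank_add_ncard_weilQuadratic_eq hexp Φ
  omega

/-- **DEGREE `32`, RANK `11`** (the simple degenerate CM abelian `16`-folds with multiquadratic complex multiplication,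
tree `cmTypeRank_eq_eleven_of_isSimple_of_not_isNondegenerate`): `Φ` is balanced over exactly `15 = C(6, 2)`
biquadratic CM subfields. [cite: Dodson1984, §3.1.1 Theorem and §3.2.1] [cite: MoonenZarhin1998WeilClasses, Criterion (Q1)] -/
theorem ncard_weilBiquadratic_eq_fifteen (hexp : ∀ g : K ≃ₐ[ℚ] K, g ^ 2 = 1) (h32 : finrank ℚ K = 32)
    (Φ : CMType K) (hr : cmTypeRank Φ = 11) :
    {L : IntermediateField ℚ K | finrank ℚ L = 4 ∧ ¬ IsTotallyReal L ∧
        ∀ σ : L →+* ℂ, {φ : K →+* ℂ | φ.comp (algebraMap L K) = σ ∧ φ ∈ Φ.1}.ncard =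
          {φ : K →+* ℂ | φ.comp (algebraMap L K) = σ ∧ φ ∉ Φ.1}.ncard}.ncard = 15 := by
  rw [ncard_weilBiquadratic_eq_choose_sub_cmTypeRank hexp Φ, h32, hr]
  decide

/-- **DEGREE `64`, RANK `17`** (e.g. the primitive near-bent types, tree `MultiquadraticCMFieldPrimitiveNearBentTypes`):
`Φ` is balanced over exactly `120 = C(16, 2)` biquadratic CM subfields. [cite: Dodson1984, §3.1.1 Theorem]
[cite: MoonenZarhin1998WeilClasses, Criterion (Q1)] -/
theorem ncard_weilBiquadratic_eq_of_finrank_eq_sixtyFour (hexp : ∀ g : K ≃ₐ[ℚ] K, g ^ 2 = 1)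
    (h64 : finrank ℚ K = 64) (Φ : CMType K) (hr : cmTypeRank Φ = 17) :
    {L : IntermediateField ℚ K | finrank ℚ L = 4 ∧ ¬ IsTotallyReal L ∧
        ∀ σ : L →+* ℂ, {φ : K →+* ℂ | φ.comp (algebraMap L K) = σ ∧ φ ∈ Φ.1}.ncard =
          {φ : K →+* ℂ | φ.comp (algebraMap L K) = σ ∧ φ ∉ Φ.1}.ncard}.ncard = 120 := by
  rw [ncard_weilBiquadratic_eq_choose_sub_cmTypeRank hexp Φ, h64, hr]
  decide

end Count

end MultiquadraticWeilSubfields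

end Literature.AlgebraicGeometry.Pohlmann1968
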